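import Mathlib.Analysis.Normed.Unbundled.RingSeminorm
import Literature.MathematicalPhysics.QuantumFieldTheory.Balaban1983to89.Beta.AveragingMixedJetTables

/-!
# `BalabanUV.Beta.D1BFx.WeightedRowSumNorm` — road «BF-x» for binder row D1, junction (J1), «SYMMIX-MASS» FILE 2 of 5: **THE WEIGHTED ROW-SUM OPERATOR NORM
# `mnorm ω M := max_j Σ_k (ω k ∕ ω j)·|M j k|` ON `Matrix ι ι ℚ` (finite `ι`, ANY positive weights) — SUBMULTIPLICATIVE WITH `‖1‖ ≤ 1`**

HONEST DEPENDENCY (cell records, verbatim): «continuum YM on T⁴ ⇐ BetaPertH ∧ nine spine estimates (0/9 proved); BetaPertH ⇐ (D1) ∧ (D4) ∧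
CAP+tail; G-an2-4 gates asym, D1 and NE2/3/4.»  HONEST FRAMING (cell contract, verbatim): «discharging `BetaPertH` makes Bałaban's UV stability
UNCONDITIONAL — a real constructive-QFT result; it is NOT the continuum limit and NOT the Clay problem.»  THIS MODULE DISCHARGES NOTHING of the
wall: [folklore] `Finset` bookkeeping over Mathlib's `Matrix ∕ RingSeminorm` (the `ℓ^∞ → ℓ^∞` operator norm of `D_ω⁻¹ |M| D_ω`); DEFINITION lane (`rowW`, `mnorm`, `mnormRS`), 0 cite,
0 `def … : Prop`, 0 sorry, imports Mathlib through lit node 12b only (no new dependency).  It prices NO word and proves NO (1.22) row; 0 root-level binders of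
row D1 discharged (hW ∕ hR-sockets ∕ hSX-socket ∕ D1Tel ∕ D1Rep = 0); (J1) ONE OPEN ROW; (K) NOT closed; NOT D1, NEVER «G-an2-4 closed», NOT `BetaPertH`, NOT
continuum, NOT Clay.

ABSOLUTE RULE (cell charter, verbatim): «No internally-minted statement may enter as a cited fact. Every hypothesis is either kernel-proved in
this package or a verbatim quotation of a PUBLISHED theorem with page reference. The manuscript(s) under audit are NOT citable for their own
disputed steps — they are the thing under adjudication; programme-internal (2001/route/tribunal) claims are never citable.»

WHY.  With the level weights `ω = t^{lv}` on the word-recording states (FILE 3), a letter that moves one level up has norm `t`, products of letters along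
a contour multiply, and the top-row mass of a level-3 element is `≤ t⁻³·‖·‖` — the whole n-law of the mixed table in one free parameter `t`.

CONTENT ([folklore] throughout).  `rowW`, `mnorm`; `rowW_le_mnorm`, `rowW_nonneg`, `entry_le_mnorm`, `sum_filter_le_mnorm` (partial rows), **`rowW_mul_le`**
(`row_j(MN) ≤ row_j(M)·‖N‖` — the weights telescope), `mnorm_nonneg`, and the seven axioms **`mnorm_zero`, `mnorm_one_le`, `mnorm_add_le`, `mnorm_neg`,
`mnorm_mul_le`, `mnorm_algebraMap_le`, `mnorm_smul_le`**, packaged as the Mathlib `RingSeminorm` **`mnormRS hω`** (`mnormRS_apply`; the two extra letters `mnorm_one_le`,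
`mnorm_smul_le` travel as the hypotheses `h1 ∕ hs` of FILE 1).
NOT HERE: the states and letters (FILE 3), any table.
Unit `b2b-balaban-beta-d1-formalise-leaf-04` (gen 29), D1 formalisation swarm LEAF PROVER 04, road «BF-x» supplier; INTENT I-leaf04-g29-1 «SYMMIX-MASS»
(journal), taking the OWNER d1-p2 g25's located WANTED «the n-law of `symMixAbs`» (W-g25-9 (a)).  Not in print; our bookkeeping.  No existing file touched.
-/

noncomputable section

open Finset
open scoped BigOperators

namespace Summit.QuantumFields.BalabanUV.Beta.D1BFx.WeightedRowSumNorm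

/-! ## §1 The weighted row-sum operator norm on rational matrices over a finite index type -/

section MatrixNorm

variable {ι : Type*} [Fintype ι]

/-- [our object] The weighted absolute row sum `Σ_k (ω k ∕ ω j)·|M j k|`. -/
def rowW (ω : ι → ℝ) (M : Matrix ι ι ℚ) (j : ι) : ℝ := ∑ k, ω k / ω j * |(M j k : ℝ)|

/-- [our object] THE WEIGHTED OPERATOR NORM `max_j Σ_k (ω k ∕ ω j)·|M j k|` (the `ℓ^∞ → ℓ^∞` norm of `D_ω⁻¹ |M| D_ω`). -/
def mnorm [Nonempty ι] (ω : ι → ℝ) (M : Matrix ι ι ℚ) : ℝ := Finset.univ.sup' Finset.univ_nonempty (rowW ω M)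

variable [Nonempty ι] {ω : ι → ℝ}

/-- [folklore] Every weighted row sum is dominated by the norm. -/
theorem rowW_le_mnorm (ω : ι → ℝ) (M : Matrix ι ι ℚ) (j : ι) : rowW ω M j ≤ mnorm ω M :=
  Finset.le_sup' (rowW ω M) (Finset.mem_univ j)

omit [Nonempty ι] in
/-- [folklore] Weighted row sums are nonnegative for positive weights. -/
theorem rowW_nonneg (hω : ∀ j, 0 < ω j) (M : Matrix ι ι ℚ) (j : ι) : 0 ≤ rowW ω M j :=
  Finset.sum_nonneg fun k _ => mul_nonneg (div_pos (hω k) (hω j)).le (abs_nonneg _)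

/-- [folklore] Every weighted entry is dominated by the norm. -/
theorem entry_le_mnorm (hω : ∀ j, 0 < ω j) (M : Matrix ι ι ℚ) (j k : ι) : ω k / ω j * |(M j k : ℝ)| ≤ mnorm ω M :=
  (Finset.single_le_sum (f := fun k => ω k / ω j * |(M j k : ℝ)|) (fun k _ => mul_nonneg (div_pos (hω k) (hω j)).le (abs_nonneg _))
    (Finset.mem_univ k)).trans (rowW_le_mnorm ω M j)

/-- [folklore] A partial weighted row sum is dominated by the norm. -/
theorem sum_filter_le_mnorm (hω : ∀ j, 0 < ω j) (M : Matrix ι ι ℚ) (j : ι) (s : Finset ι) :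
    ∑ k ∈ s, ω k / ω j * |(M j k : ℝ)| ≤ mnorm ω M :=
  (Finset.sum_le_sum_of_subset_of_nonneg (Finset.subset_univ s)
    (fun k _ _ => mul_nonneg (div_pos (hω k) (hω j)).le (abs_nonneg _))).trans (rowW_le_mnorm ω M j)

/-- [folklore] The weighted row sum of a product. -/
theorem rowW_mul_le (hω : ∀ j, 0 < ω j) (M N : Matrix ι ι ℚ) (j : ι) : rowW ω (M * N) j ≤ rowW ω M j * mnorm ω N := by
  have hωj := hω j
  calc rowW ω (M * N) j
      ≤ ∑ k, ∑ l, ω k / ω j * (|(M j l : ℝ)| * |(N l k : ℝ)|) := by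
        refine Finset.sum_le_sum fun k _ => ?_
        rw [Matrix.mul_apply, Rat.cast_sum, ← Finset.mul_sum]
        refine mul_le_mul_of_nonneg_left ((Finset.abs_sum_le_sum_abs _ _).trans (le_of_eq ?_)) (div_pos (hω k) hωj).le
        exact Finset.sum_congr rfl fun l _ => by rw [Rat.cast_mul, abs_mul]
    _ = ∑ l, (ω l / ω j * |(M j l : ℝ)|) * ∑ k, ω k / ω l * |(N l k : ℝ)| := by
        rw [Finset.sum_comm]
        refine Finset.sum_congr rfl fun l _ => ?_
        rw [Finset.mul_sum]
        refine Finset.sum_congr rfl fun k _ => ?_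
        have hl := (hω l).ne'
        field_simp
    _ ≤ ∑ l, (ω l / ω j * |(M j l : ℝ)|) * mnorm ω N :=
        Finset.sum_le_sum fun l _ => mul_le_mul_of_nonneg_left (rowW_le_mnorm ω N l) (mul_nonneg (div_pos (hω l) hωj).le (abs_nonneg _))
    _ = rowW ω M j * mnorm ω N := by rw [rowW, Finset.sum_mul]

/-- [folklore] `0 ≤ mnorm`. -/
theorem mnorm_nonneg (hω : ∀ j, 0 < ω j) (M : Matrix ι ι ℚ) : 0 ≤ mnorm ω M :=
  (rowW_nonneg hω M (Classical.arbitrary ι)).trans (rowW_le_mnorm ω M _)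

/-- [folklore] `‖0‖ = 0`. -/
theorem mnorm_zero (hω : ∀ j, 0 < ω j) : mnorm ω (0 : Matrix ι ι ℚ) = 0 := by
  refine le_antisymm (Finset.sup'_le _ _ fun j _ => ?_) (mnorm_nonneg hω 0)
  simp [rowW]

/-- [folklore] `‖1‖ ≤ 1`. -/
theorem mnorm_one_le [DecidableEq ι] (hω : ∀ j, 0 < ω j) : mnorm ω (1 : Matrix ι ι ℚ) ≤ 1 := by
  refine Finset.sup'_le _ _ fun j _ => ?_
  rw [rowW, Finset.sum_eq_single j (fun k _ hk => by simp [Matrix.one_apply_ne' hk]) (by simp)]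
  simp [div_self (hω j).ne']

/-- [folklore] Triangle inequality. -/
theorem mnorm_add_le (hω : ∀ j, 0 < ω j) (M N : Matrix ι ι ℚ) : mnorm ω (M + N) ≤ mnorm ω M + mnorm ω N := by
  refine Finset.sup'_le _ _ fun j _ => ?_
  calc rowW ω (M + N) j ≤ rowW ω M j + rowW ω N j := by
        rw [rowW, rowW, rowW, ← Finset.sum_add_distrib]
        refine Finset.sum_le_sum fun k _ => ?_
        rw [Matrix.add_apply, Rat.cast_add, ← mul_add]
        exact mul_le_mul_of_nonneg_left (abs_add_le _ _) (div_pos (hω k) (hω j)).le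
    _ ≤ mnorm ω M + mnorm ω N := add_le_add (rowW_le_mnorm ω M j) (rowW_le_mnorm ω N j)

/-- [folklore] `‖−M‖ = ‖M‖`. -/
theorem mnorm_neg (M : Matrix ι ι ℚ) : mnorm ω (-M) = mnorm ω M := by
  unfold mnorm rowW
  simp only [Matrix.neg_apply, Rat.cast_neg, abs_neg]

/-- [folklore] **SUBMULTIPLICATIVITY** `‖MN‖ ≤ ‖M‖·‖N‖`. -/
theorem mnorm_mul_le (hω : ∀ j, 0 < ω j) (M N : Matrix ι ι ℚ) : mnorm ω (M * N) ≤ mnorm ω M * mnorm ω N := by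
  refine Finset.sup'_le _ _ fun j _ => (rowW_mul_le hω M N j).trans ?_
  exact mul_le_mul_of_nonneg_right (rowW_le_mnorm ω M j) (mnorm_nonneg hω N)

/-- [folklore] Scalars: `‖algebraMap c‖ ≤ |c|`. -/
theorem mnorm_algebraMap_le [DecidableEq ι] (hω : ∀ j, 0 < ω j) (c : ℚ) : mnorm ω (algebraMap ℚ (Matrix ι ι ℚ) c) ≤ |(c : ℝ)| := by
  refine Finset.sup'_le _ _ fun j _ => ?_
  rw [rowW, Finset.sum_eq_single j (fun k _ hk => by simp [Matrix.algebraMap_matrix_apply, hk.symm]) (by simp)]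
  simp [Matrix.algebraMap_matrix_apply, div_self (hω j).ne']

/-- [folklore] Homogeneity through the scalars: `‖(algebraMap c)·M‖ ≤ |c|·‖M‖`. -/
theorem mnorm_smul_le [DecidableEq ι] (hω : ∀ j, 0 < ω j) (c : ℚ) (M : Matrix ι ι ℚ) :
    mnorm ω (algebraMap ℚ (Matrix ι ι ℚ) c * M) ≤ |(c : ℝ)| * mnorm ω M :=
  (mnorm_mul_le hω _ _).trans (mul_le_mul_of_nonneg_right (mnorm_algebraMap_le hω c) (mnorm_nonneg hω M))

/-- [our object] THE WEIGHTED OPERATOR NORM AS A Mathlib `RingSeminorm` (positive weights). -/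
def mnormRS (hω : ∀ j, 0 < ω j) : RingSeminorm (Matrix ι ι ℚ) where
  toFun := mnorm ω
  map_zero' := mnorm_zero hω
  add_le' := mnorm_add_le hω
  neg' := mnorm_neg
  mul_le' := mnorm_mul_le hω

/-- [folklore] `mnormRS hω M = mnorm ω M`. -/
@[simp] theorem mnormRS_apply (hω : ∀ j, 0 < ω j) (M : Matrix ι ι ℚ) : mnormRS hω M = mnorm ω M := rfl

end MatrixNorm


end Summit.QuantumFields.BalabanUV.Beta.D1BFx.WeightedRowSumNorm

end
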